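import Summits.PneNP.PneNP.Theses.OneSlice
import Summits.PneNP.PneNP.Theorems.ConstantBand.Negative.LoadBearing
import Summits.PneNP.PneNP.Theorems.SliceACZero.Negative.DeltaBeforeK
import Summits.PneNP.PneNP.Theorems.SingleThreshold.Negative.LoadBearing
import Summits.PneNP.PneNP.Theorems.SingleThreshold.Negative.Locality
import Summits.PneNP.PneNP.Theorems.OneSliceSliceMonotonization

/-!
# Disproof of `SliceTarget` — findings (standing disprover `cdisprove-stmt-PneNP-2832`, gen 1, cycles 1–2)

Crux `stmt-PneNP-2832` = `Summit.PneNP.PneNP.Theses.OneSlice.SliceTarget` = the TARGET X of route PneNP/OneSlice: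
`∀ c, ∃ k ≥ 3, ∃ δ > 0, ∀ᶠ n, ∀ j` central (`|j - m_k(n)| ≤ m_k(n)^{3/4}`, `m_k(n) = ⌊C(n,2)·n^{-2/(k-1)}⌋₊`),
`∀ C` over `{∧₂, ∨₂}` on the `C(n,2)` edge variables of `K_n`:
`#{x : e(x) = j, C(x) ≠ CLIQUE_k(x)} ≤ δ · #{x : e(x) = j} ⟹ n^c < |C|`.

VERDICT (cycle 1): **not refuted, not mis-stated.** The statement elaborates (rc 0); its inline clique function,
edge count and threshold ARE the library's `cliqueFn`, `edgeCount`, `thr`/`mk` (`sliceTarget_iff`, by `Iff.rfl`); it has no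
junk (real `δ·#slice` instead of a division; `k - 1 ≥ 2` in the exponent; `n = 0` absorbed by `∀ᶠ`; the window lies in
`(0, C(n,2))` eventually, `eventually_central_pos_lt`); its hypothesis class is inhabited at every `(n, j)` by the exact
monotone DNF, so it is neither vacuous nor trivially true; and X is definitionally rung #3 `ConstantBand` frozen at width
`w = 0` (`sliceTarget_iff_bandLB_zero`), so every `w = 0` instance of the ConstantBand lane's negative lemmas is a lemma here.

Findings (all `sorry`-free; everything below imports only LANDED modules):
* §0 `sliceTarget_iff`, `sliceLB_iff_bandLB_zero`, `sliceTarget_iff_bandLB_zero` (X = `∀ c ∃ k ≥ 3 ∃ δ > 0, BandLB c k 0 δ`,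
  whence `TargetImpliesBand` is one line), `not_sliceTarget_iff` — WHAT A KILL MUST DELIVER: one exponent `c` and, for
  EVERY `k ≥ 3` and EVERY `δ > 0`, infinitely many `n` with a central `j` and a `{∧₂,∨₂}`-circuit of `≤ n^c` gates erring on
  `≤ δ·#slice_j` graphs of slice `j`; `SliceLB.anti_delta/anti_exp`.
* §1 LOAD-BEARING hypotheses, each dropped version refuted by a circuit with `≤ C(n,2)` gates:
  `sliceTarget_false_without_basis` (one table gate, exact, `c = 0`); `sliceTarget_false_without_central` with BOTH ends
  separately — `not_sliceLBNoWindow_bottom` (`j = 0`: the slice is `{∅}`, `x_e = 0 = CLIQUE_k`, kills exponent `0`, no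
  asymptotics) and `not_sliceLBNoWindow_top` (`j = C(n,2)`: the slice is `{K_n}`, OR of all edges, kills exponent `2`);
  `sliceTarget_false_without_accuracy` (`x_e`, no gates). The guard `3 ≤ k` is REDUNDANT: `three_le_of_sliceLB` — for
  `k = 2` the window is the single slice `j = 0` (`thr_two`, `central_two_iff`), for `k = 1` the centre is the full slice
  `{K_n}` (`thr_one`: the exponent `-2/0` is junk `0`), for `k = 0` the centre `C(n,2)·n²` is an EMPTY slice (`thr_zero`); in
  all three the inner clause fails for every `c` and `δ ≥ 0`, so dropping the guard changes nothing.
* §2 TIGHTNESS of the witnesses: `not_sliceLB_of_le` — `k ≤ c` is impossible for every `δ ≥ 0` (exact DNF,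
  `C(n,k)(C(k,2)+1) ≤ C(n,k)·k! ≤ n^k` gates, `dnfSize_le_pow`), so `k ≥ c + 1` (`exponent_lt_of_sliceLB`);
  `not_sliceLB_of_factorial_inv_lt` — `δ > 1/k!` is impossible at EVERY `c` (on the central slice `j = m_k(n)` the gate-free
  `x_{e₀}` errs on `≤ (m_k(n)/C(n,2) + 1/k!)·#slice`, by the hypergeometric single-edge count `card_slice_filter_true_le` and
  the SliceACZero lane's `firstMoment_slice`; `m_k(n)/C(n,2) ≤ n^{-2/(k-1)} → 0`), so `δ ≤ 1/k!` (`delta_le_of_sliceLB`);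
  together `witness_shape : SliceLB c k δ → c < k ∧ δ ≤ 1/k!` — a proof of X at exponent `c` is a statement about
  `(c+1)!^{-1}`-accurate circuits at the least (true requirement `k ≳ 4c`, `δ < 1 - e^{-1/k!}`; see "not attempted").
* §3 NATURAL STRENGTHENINGS refuted: `not_sliceTargetKFirst` (one `k` for all `c`), `not_sliceTargetForallK` (every
  `k ≥ 3`; dies at `k = c = 3`), `not_sliceTargetDeltaFirst` (`∃ δ ∀ c ∃ k`: at `c = ⌈1/δ⌉₊ + 2` a witness `k ≤ c` dies by
  the DNF and `k ≥ c + 1` by `x_e`, `factorial_inv_lt_of_lt`). So `k(c) → ∞` AND `δ(c) → 0` are both forced.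
* §4 X IS A GENERAL-CIRCUIT STATEMENT (Berkowitz, kernel-checked modulo the route's support item): `SliceTargetB2` = X over
  the full binary basis `B₂`; `sliceTarget_iff_B2 (hM : SliceMonotonization) : SliceTarget ↔ SliceTargetB2` — the forward
  direction monotonizes a small accurate `B₂`-circuit on the slice (same error set, `errSet_congr`; `≤ c₀(n^c + n^{c₀}) <
  n^{c+c₀+1}` gates, `eventually_monotonization_small`) and applies X at exponent `c + c₀ + 1`. `SliceMonotonization` is
  PROVED in tree (`Summit.PneNP.PneNP.Theorems.sliceMonotonization_proof`, p78537), so §4b has the UNCONDITIONAL forms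
  `sliceTarget_iff_B2_holds`, `not_sliceTarget_iff_B2` (axioms: the standard three). A kill may use negations and constants freely.
* §5 WEAKENINGS that still close the route: `SliceTargetExact` (`δ = 0`: worst case on the slice), `SliceTargetIO` (`∃ᶠ n`),
  `SliceTargetExactIO`, `SliceTargetMin` (exact, central slice only, i.o.); all implied by X (`…_of_sliceTarget`); the assembly
  (item 10382) consumes X only at `j = m_k(n)` with error EXACTLY `0` at ONE large `n`, so `SliceTargetMin` already suffices
  for `closes` — X over-delivers along three axes (average case, almost-everywhere, uniformity over the window). Even the
  weakest forms force `k > c` (`exactIO_exponent_lt`).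

* §6 LINE `Sketch-ideator3-r1` (picked 06:18Z; stubs T1 T2 T4 T5 T6 landed by 07:10Z): T3 `FibreCliqueLower` is TRUE for
  `k ≥ 4` and both its guards are load-bearing by one mechanism (`not_fibreCliqueLowerWith_of_frequently`: a cap admitting
  `#F = m_k(n)` lets `F = supp x₀` make the fibre `{x₀}` with no clique off `F`) — `fibreCliqueLower_false_at_three` (`k = 3`:
  `m_3(n) ≤ 3n`), `fibreCliqueLower_false_uncapped` (no cap, every `k`), `fibreCliqueLowerWith_cap_lt` (any admissible cap has
  `B n < m_k(n)` eventually). T7 `ParitySliceHardFrom2` (OPEN) is crux-strength, not refuted; its witnesses obey X's shape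
  (`not_parityLB_of_le`: `k ≥ c+1`, modulo T5; `not_parityLB_of_factorial_inv_lt`: `δ ≤ 1/k!`), and `parityLB_of_sliceLB` /
  `parityFrom2_of_sliceTarget_large` pin its excess over the conjunct X(≥2): T7 ⟸ X(≥2) with witnesses `δ_X > (3/2)(1/k!)²`
  (T7 ⟹ X(≥2) being the line's `sliceLB_of_parity`), while X's own `δ_X` is unforced below `1/k!`.

WHY IT RESISTS (numbers, not adjectives):
* By §0/§4 a disproof is a FIXED-EXPONENT AVERAGE-CASE CLIQUE ALGORITHM AT CRITICALITY: one `c` such that for every `k`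
  general size-`n^c` circuits decide `k`-CLIQUE on the critical slice `G(n, m_k(n))` with error `≤ δ·#slice` for every
  `δ > 0`, infinitely often. Fastest known: `n^{k/4+O(1)}` (Rossman FOCS'10 Thm 3 = `Rossman2010_upperBound`; Amano 2010;
  restated as "the fastest algorithm known ... any substantial improvement to the `n^{k/4+O(1)}` algorithm would be a major
  breakthrough" in Fountoulakis–Friedrich–Hermelin, TCS 2015 = arXiv:1410.6400, §1 p.3, who for that reason EXCLUDE
  `p = Θ(n^{-2/(k-1)})` from their avgFPT theorems: their sparse-case exponent is `s₀ + 4`, `s₀ = 2⌈4/c_g⌉ + 1 ≈ 4k` at the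
  threshold density `n^{-c_g}`, `c_g = 2/(k-1)` — §3.2 p.7). Enumeration meets the same wall: the expected number of
  `i`-cliques on the critical slice is `n^{i(k-i)/(k-1)}/i!`, maximal `≈ n^{k/4+1/4}` at `i = k/2`; degeneracy-ordered
  listing (Chiba–Nishizeki) costs `m·d^{k-2} = n^{k-2}`. Rossman conjectures `n^{Ω(k)}` for ALL circuits at `p_c`
  (FOCS'10 §9, p.11 of the held text; ECCC TR16-206 p.20: "syntactic = semantic monotonicity in the average case").
* Trivial circuits do not slip under `δ`: on every central slice `P[CLIQUE_k = 1] → 1 - e^{-1/k!}` (`0.154, 0.041, 0.0083`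
  for `k = 3,4,5`) uniformly over the window (the clique density moves by `(1 ± m^{-1/4})^{C(k,2)} → 1`), and `δ` is chosen
  AFTER `k`; §2 extracts all that this gives (`δ ≤ 1/k!`).
* No degenerate instance: §1 shows every hypothesis is used and the guard is cosmetic; the three route reviews (g16-17,
  g44-8, g47-0) and this read-back agree symbol by symbol.
* Barriers bite PROOFS, not kills. Beyond the route's list (MonotoneGap — evaded at `w = 0` by Berkowitz; ApproximationMethodLimit;
  NaturalProofs), one catalogued barrier applies to X and is NOT cited by the route: `Literature.Barriers.PneNP.RelativizedCircuitSize`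
  (Wilson 1985, Thm 3.1: `∃ B, Δ₂^{P,B} ⊆ SIZE^B(2n + o(n))`). Reason: by §5 + §4, X implies for every `c` a language in
  `DTIME(n^{k(c)+O(1)}) ⊆ P` — "`n`-vertex graphs with exactly `m_k(n)` edges containing a `k`-clique" — outside `SIZE(n^c)`
  for ALL large `n`: fixed-polynomial circuit lower bounds for P, almost everywhere (and on average), which (a) do not follow
  from `NP ⊄ P/poly` (consistent with the item's own "X can fail while PneNP holds") and (b) admit no relativizing proof in
  Wilson's oracle-circuit model. Planner note only; it does not make X false.
* `ledger negatives --problem PneNP` (checked this cycle): no clique / slice / threshold entry to reuse.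

NOT ATTEMPTED / NEAR-MISSES (for later cycles; nothing here is `sorry`ed):
* the true `δ`-floor `1 - e^{-1/k!}` (second moment / Poisson approximation on the slice `G(n,j)`; the lanes hold only first
  moments: `firstMoment_slice`, `gnpProb_clique_le`);
* the locality floor `c ≤ 1` (SingleThreshold lane `lowerBoundAt_of_le_one`: below `n²` gates a circuit reads `o(n²)` edges
  and is nearly independent of `CLIQUE_k`) has no slice analogue yet — on `G(n,j)` the edges are negatively associated, so the
  product-measure independence `gnpProb_and_eq_mul` must be replaced by a hypergeometric decoupling; it would show that the
  content of X starts at `c = 2` exactly as for rung #2;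
* the `k = 3` corner `SliceLB 2 3 δ` (is sub-cubic average-case monotone TRIANGLE detection on the slice `m ≈ n/2` possible?
  irrelevant to X's `∃ k` but the cheapest calibration of any closure method on one slice).
-/

set_option linter.dupNamespace false

namespace Summit.PneNP.PneNP.Cruxes.SliceTarget.Disproof

open Literature.Computability.Complexity Filter Finset Classical
open Summit.PneNP.PneNP.Theses.OneSlice (SliceTarget ConstantBand SliceMonotonization)
open Summit.PneNP.PneNP.Theorems.ConstantBand.Negative (Edge thr Central central_thr slice errSet bandErr
  BandLB bandErr_eq_zero_of_eval exists_oneGate_cliqueFn cliqueFn_eq_true_of_card_false_le le_choose_two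
  exists_orAll)
open Summit.PneNP.PneNP.Theorems.SliceACZero.Negative (mk sliceCard sliceErr sliceCard_eq card_slice_supset_le
  choose_sub_mul_pow_le_choose_mul_pow firstMoment_slice mk_le_choose choose_le_edgeCount_of_cliqueFn
  eq_false_of_edgeCount_eq_zero eq_true_of_edgeCount_eq cliqueFn_false cliqueFn_true exists_edge input_facts
  factorial_inv_le_of_ceil_lt)
open Summit.PneNP.PneNP.Theorems.SingleThreshold.Negative (pc pc_nonneg pc_le_one tendsto_pc
  exists_monotone_cliqueCircuit choose_mul_le_pow)

/-! ## §0 Read-back, schedule form, bridge to `ConstantBand` at width `0` -/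

/-- The crux at fixed parameters `(c, k, δ)`: eventually in `n`, every `{∧₂, ∨₂}`-circuit that errs on at
most a `δ`-fraction of a central slice `j` has more than `n^c` gates. [folklore] -/
def SliceLB (c k : ℕ) (δ : ℝ) : Prop :=
  ∀ᶠ n : ℕ in atTop, ∀ j : ℕ, Central k n j → ∀ C : Circuit (Edge n), C.IsOver monotoneBasis →
    (#(errSet n k j C) : ℝ) ≤ δ * #(slice n j) → n ^ c < C.size

/-- **Read-back.** The crux is `∀ c, ∃ k ≥ 3, ∃ δ > 0, SliceLB c k δ` — definitionally (the inline clique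
function is `cliqueFn`, the inline edge count is `edgeCount`, the inline threshold is `thr`). [folklore] -/
theorem sliceTarget_iff : SliceTarget ↔ ∀ c : ℕ, ∃ k : ℕ, 3 ≤ k ∧ ∃ δ : ℝ, 0 < δ ∧ SliceLB c k δ :=
  Iff.rfl

/-- Vocabulary check: `thr k n` (ConstantBand lane) is `mk n k` (SliceACZero lane). [folklore] -/
theorem thr_eq_mk (k n : ℕ) : thr k n = mk n k := rfl

/-- Vocabulary check: `#(slice n j)` is `sliceCard n j`. [folklore] -/
theorem card_slice_eq_sliceCard (n j : ℕ) : #(slice n j) = sliceCard n j := rfl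

/-- Vocabulary check: `#(errSet n k j C)` is `sliceErr n j C.eval (cliqueFn n k)`. [folklore] -/
theorem card_errSet_eq_sliceErr (n k j : ℕ) (C : Circuit (Edge n)) :
    #(errSet n k j C) = sliceErr n j C.eval (cliqueFn n k) := rfl

/-- The error set lives in its slice. [folklore] -/
theorem errSet_subset_slice (n k j : ℕ) (C : Circuit (Edge n)) : errSet n k j C ⊆ slice n j :=
  fun _ hx => mem_filter.2 ⟨mem_univ _, (mem_filter.1 hx).2.1⟩

/-- Slices above `C(n,2)` are empty (`#slice_j = C(C(n,2), j)` is the SliceACZero lane's `sliceCard_eq`). [folklore] -/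
theorem card_slice_eq_zero {n j : ℕ} (h : n.choose 2 < j) : #(slice n j) = 0 := by
  rw [card_slice_eq_sliceCard, sliceCard_eq, Nat.choose_eq_zero_of_lt h]

/-- An error set is empty when the circuit is right on the slice. [folklore] -/
theorem errSet_eq_empty_of {n k j : ℕ} {C : Circuit (Edge n)}
    (h : ∀ x : Edge n → Bool, edgeCount x = j → C.eval x = cliqueFn n k x) : errSet n k j C = ∅ :=
  filter_eq_empty_iff.2 fun x _ hx => hx.2 (h x hx.1)

/-- Circuits that agree on the slice have the same error set there. [folklore] -/
theorem errSet_congr {n k j : ℕ} {C C' : Circuit (Edge n)}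
    (h : ∀ x : Edge n → Bool, edgeCount x = j → C'.eval x = C.eval x) : errSet n k j C' = errSet n k j C := by
  refine filter_congr fun x _ => ?_
  constructor
  · rintro ⟨hj, hne⟩; exact ⟨hj, by rwa [← h x hj]⟩
  · rintro ⟨hj, hne⟩; exact ⟨hj, by rwa [h x hj]⟩

/-- **Bridge to rung #3 at width `0`.** Slice accuracy `#err_j ≤ δ·#slice_j` IS band accuracy
`bandErr n k j 0 C ≤ δ` (for `δ ≥ 0`; on an empty slice both are vacuous). [folklore] -/
theorem sliceAcc_iff_bandErr_zero {n k j : ℕ} {δ : ℝ} (hδ : 0 ≤ δ) (C : Circuit (Edge n)) :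
    (#(errSet n k j C) : ℝ) ≤ δ * #(slice n j) ↔ bandErr n k j 0 C ≤ δ := by
  have hb : bandErr n k j 0 C = (#(errSet n k j C) : ℝ) / #(slice n j) := by
    rw [bandErr, Nat.sub_zero, Nat.add_zero, Icc_self, sum_singleton]
  rw [hb]
  by_cases hs : #(slice n j) = 0
  · have he : #(errSet n k j C) = 0 :=
      Nat.eq_zero_of_le_zero (hs ▸ card_le_card (errSet_subset_slice n k j C))
    rw [he, hs]; simp [hδ]
  · have hs' : (0 : ℝ) < #(slice n j) := by exact_mod_cast Nat.pos_of_ne_zero hs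
    rw [div_le_iff₀ hs']

/-- `SliceLB c k δ` is `BandLB c k 0 δ` (`δ ≥ 0`). [folklore] -/
theorem sliceLB_iff_bandLB_zero {c k : ℕ} {δ : ℝ} (hδ : 0 ≤ δ) : SliceLB c k δ ↔ BandLB c k 0 δ := by
  constructor
  · intro H
    filter_upwards [H] with n hn j hj C hC herr
    exact hn j hj C hC ((sliceAcc_iff_bandErr_zero hδ C).2 herr)
  · intro H
    filter_upwards [H] with n hn j hj C hC herr
    exact hn j hj C hC ((sliceAcc_iff_bandErr_zero hδ C).1 herr)

/-- **`SliceTarget` is `ConstantBand` with the width frozen at `w = 0`**: so `TargetImpliesBand` (item 2838)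
is one line, and every `w = 0` instance of a negative lemma on rung #3 is a lemma on X. [folklore] -/
theorem sliceTarget_iff_bandLB_zero :
    SliceTarget ↔ ∀ c : ℕ, ∃ k : ℕ, 3 ≤ k ∧ ∃ δ : ℝ, 0 < δ ∧ BandLB c k 0 δ := by
  rw [sliceTarget_iff]
  refine forall_congr' fun c => exists_congr fun k => and_congr_right fun _ =>
    exists_congr fun δ => and_congr_right fun hδ => sliceLB_iff_bandLB_zero hδ.le

/-- Smaller `δ` = weaker claim. [folklore] -/
theorem SliceLB.anti_delta {c k : ℕ} {δ δ' : ℝ} (h : δ' ≤ δ) (H : SliceLB c k δ) : SliceLB c k δ' := by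
  filter_upwards [H] with n hn j hj C hC herr
  exact hn j hj C hC (herr.trans (mul_le_mul_of_nonneg_right h (Nat.cast_nonneg _)))

/-- Smaller exponent = weaker claim. [folklore] -/
theorem SliceLB.anti_exp {c c' k : ℕ} {δ : ℝ} (h : c' ≤ c) (H : SliceLB c k δ) : SliceLB c' k δ := by
  filter_upwards [H, eventually_ge_atTop 1] with n hn h1 j hj C hC herr
  exact lt_of_le_of_lt (Nat.pow_le_pow_right h1 h) (hn j hj C hC herr)

/-- Negation of the schedule form. [folklore] -/
theorem not_sliceLB_iff {c k : ℕ} {δ : ℝ} :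
    ¬ SliceLB c k δ ↔ ∃ᶠ n : ℕ in atTop, ∃ j : ℕ, Central k n j ∧ ∃ C : Circuit (Edge n),
      C.IsOver monotoneBasis ∧ (#(errSet n k j C) : ℝ) ≤ δ * #(slice n j) ∧ C.size ≤ n ^ c := by
  rw [SliceLB, not_eventually]
  constructor
  · intro h
    refine h.mono fun n hn => ?_
    by_contra hcon
    apply hn
    intro j hj C hC herr
    by_contra hlt
    exact hcon ⟨j, hj, C, hC, herr, not_lt.1 hlt⟩
  · intro h
    refine h.mono fun n hn hall => ?_
    obtain ⟨j, hj, C, hC, herr, hs⟩ := hn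
    exact absurd (hall j hj C hC herr) (not_lt.2 hs)

/-- **What a kill must deliver**: ONE exponent `c` and, for EVERY `k ≥ 3` and EVERY `δ > 0`, infinitely many
`n` with a central `j` and a monotone circuit of size `≤ n^c` erring on `≤ δ·#slice_j` graphs of slice `j`. [folklore] -/
theorem not_sliceTarget_iff :
    ¬ SliceTarget ↔ ∃ c : ℕ, ∀ k : ℕ, 3 ≤ k → ∀ δ : ℝ, 0 < δ →
      ∃ᶠ n : ℕ in atTop, ∃ j : ℕ, Central k n j ∧ ∃ C : Circuit (Edge n), C.IsOver monotoneBasis ∧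
        (#(errSet n k j C) : ℝ) ≤ δ * #(slice n j) ∧ C.size ≤ n ^ c := by
  rw [sliceTarget_iff]
  push Not
  simp only [not_sliceLB_iff]

/-- The gate-free projection `x_e` has size `0`, is over every basis, and reads `x e`. [folklore] -/
theorem input_isOver {n : ℕ} (e : Edge n) (B : Set GateFn) : (Circuit.input e).IsOver B :=
  (input_facts e B).1

/-! ## §1 Load-bearing hypotheses

The crux has four hypotheses on the data `(j, C)`: the WINDOW `Central k n j`, the BASIS `C.IsOver monotoneBasis`,
the ACCURACY `#err ≤ δ·#slice`, and the guard `3 ≤ k` on the witness. The first three are load-bearing (each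
dropped version is refuted below by a circuit with at most `C(n,2)` gates); the guard `3 ≤ k` is REDUNDANT
(`three_le_of_sliceLB`: no `k ≤ 2` can witness anyway). -/

/-- The crux with the BASIS hypothesis dropped (arbitrary gates of arbitrary fan-in). [folklore] -/
def SliceTargetWithoutBasis : Prop :=
  ∀ c : ℕ, ∃ k : ℕ, 3 ≤ k ∧ ∃ δ : ℝ, 0 < δ ∧ ∀ᶠ n : ℕ in atTop, ∀ j : ℕ, Central k n j →
    ∀ C : Circuit (Edge n), (#(errSet n k j C) : ℝ) ≤ δ * #(slice n j) → n ^ c < C.size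

/-- **The basis restriction is load-bearing**: one gate of fan-in `C(n,2)` whose table is `CLIQUE_k` is exact on
every slice (size `1`), so the basis-free crux fails already at `c = 0`. [folklore] -/
theorem sliceTarget_false_without_basis : ¬ SliceTargetWithoutBasis := by
  intro h
  obtain ⟨k, -, δ, hδ, hev⟩ := h 0
  obtain ⟨n, hn⟩ := hev.exists
  obtain ⟨C, hs, he⟩ := exists_oneGate_cliqueFn n k
  have hlt := hn (thr k n) (central_thr k n) C
    (by rw [errSet_eq_empty_of fun x _ => he x, card_empty, Nat.cast_zero]; positivity)
  simp only [pow_zero] at hlt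
  omega

/-- The inner clause with the WINDOW dropped (every edge count `j`), at parameters `(c, k, δ)`. [folklore] -/
def SliceLBNoWindow (c k : ℕ) (δ : ℝ) : Prop :=
  ∀ᶠ n : ℕ in atTop, ∀ j : ℕ, ∀ C : Circuit (Edge n), C.IsOver monotoneBasis →
    (#(errSet n k j C) : ℝ) ≤ δ * #(slice n j) → n ^ c < C.size

/-- The crux with the WINDOW hypothesis dropped. [folklore] -/
def SliceTargetWithoutCentral : Prop :=
  ∀ c : ℕ, ∃ k : ℕ, 3 ≤ k ∧ ∃ δ : ℝ, 0 < δ ∧ SliceLBNoWindow c k δ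

/-- **Bottom end** (`j = 0`, exponent `0`, every `k ≥ 2`, `δ ≥ 0`): the only graph of slice `0` is empty,
`CLIQUE_k(∅) = 0 = x_e`, so the gate-free circuit `x_e` is EXACT there — no window, no lower bound. [folklore] -/
theorem not_sliceLBNoWindow_bottom (c : ℕ) {k : ℕ} (hk : 2 ≤ k) {δ : ℝ} (hδ : 0 ≤ δ) :
    ¬ SliceLBNoWindow c k δ := by
  intro H
  obtain ⟨n, hn, hn2⟩ := (H.and (eventually_ge_atTop 2)).exists
  obtain ⟨e₀⟩ := exists_edge hn2
  have hexact : ∀ x : Edge n → Bool, edgeCount x = 0 → (Circuit.input e₀).eval x = cliqueFn n k x := by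
    intro x hx
    rw [eq_false_of_edgeCount_eq_zero hx, Circuit.eval_input, cliqueFn_false hk]
  have hlt := hn 0 (Circuit.input e₀) (input_isOver e₀ _)
    (by rw [errSet_eq_empty_of hexact, card_empty, Nat.cast_zero]; positivity)
  rw [Circuit.size_input] at hlt
  exact Nat.not_lt_zero _ hlt

/-- **Top end** (`j = C(n,2)`, exponent `2`, every `k`, `δ ≥ 0`): the only graph of the top slice is `K_n`,
`CLIQUE_k(K_n) = 1` (`n ≥ k`) and the OR of all edges (`≤ C(n,2) < n²` gates) is `1` there. [folklore] -/
theorem not_sliceLBNoWindow_top {c : ℕ} (hc : 2 ≤ c) (k : ℕ) {δ : ℝ} (hδ : 0 ≤ δ) :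
    ¬ SliceLBNoWindow c k δ := by
  intro H
  obtain ⟨n, hn, hnk⟩ := (H.and (eventually_ge_atTop (k + 2))).exists
  obtain ⟨C, hCB, hs, he⟩ := exists_orAll n (by omega)
  obtain ⟨e₀⟩ := exists_edge (by omega : 2 ≤ n)
  have hexact : ∀ x : Edge n → Bool, edgeCount x = n.choose 2 → C.eval x = cliqueFn n k x := by
    intro x hx
    rw [eq_true_of_edgeCount_eq hx, cliqueFn_true (by omega : k ≤ n)]
    exact (he _).2 ⟨e₀, rfl⟩
  have hlt := hn (n.choose 2) C hCB
    (by rw [errSet_eq_empty_of hexact, card_empty, Nat.cast_zero]; positivity)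
  have h1 : n.choose 2 < n ^ 2 := Nat.choose_lt_pow (by omega) le_rfl
  have h2 : n ^ 2 ≤ n ^ c := Nat.pow_le_pow_right (by omega) hc
  omega

/-- **The window is load-bearing** (at both ends; the bottom end kills exponent `0`). [folklore] -/
theorem sliceTarget_false_without_central : ¬ SliceTargetWithoutCentral := by
  intro h
  obtain ⟨k, hk, δ, hδ, H⟩ := h 0
  exact not_sliceLBNoWindow_bottom 0 (by omega) hδ.le H

/-- The crux with the ACCURACY hypothesis dropped. [folklore] -/
def SliceTargetWithoutAccuracy : Prop :=
  ∀ c : ℕ, ∃ k : ℕ, 3 ≤ k ∧ ∀ᶠ n : ℕ in atTop, ∀ j : ℕ, Central k n j →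
    ∀ C : Circuit (Edge n), C.IsOver monotoneBasis → n ^ c < C.size

/-- **Accuracy is load-bearing** (trivially: `x_e` is a monotone circuit with no gate). [folklore] -/
theorem sliceTarget_false_without_accuracy : ¬ SliceTargetWithoutAccuracy := by
  intro h
  obtain ⟨k, -, hev⟩ := h 0
  obtain ⟨n, hn, hn2⟩ := (hev.and (eventually_ge_atTop 2)).exists
  obtain ⟨e₀⟩ := exists_edge hn2
  have hlt := hn (thr k n) (central_thr k n) (Circuit.input e₀) (input_isOver e₀ _)
  rw [Circuit.size_input] at hlt
  exact Nat.not_lt_zero _ hlt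

/-! ### The guard `3 ≤ k` is redundant: `k ≤ 2` never witnesses -/

/-- `thr 2 n = 0`: for `k = 2` the threshold `⌊C(n,2)·n^{-2}⌋₊` vanishes (`C(n,2) < n²`). [folklore] -/
theorem thr_two (n : ℕ) : thr 2 n = 0 := by
  rw [thr]
  apply Nat.floor_eq_zero.2
  rcases Nat.eq_zero_or_pos n with rfl | hn
  · simp
  have hn0 : (0 : ℝ) < n := by exact_mod_cast hn
  have hpow : (n : ℝ) ^ (-(2 : ℝ) / (((2 : ℕ) : ℝ) - 1)) = ((n : ℝ) ^ 2)⁻¹ := by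
    rw [show (((2 : ℕ) : ℝ) - 1) = 1 by norm_num, div_one, Real.rpow_neg hn0.le, Real.rpow_two]
  rw [hpow]
  have hN : ((n.choose 2 : ℕ) : ℝ) < (n : ℝ) ^ 2 := by
    exact_mod_cast Nat.choose_lt_pow (by omega) le_rfl
  rw [mul_inv_lt_iff₀ (by positivity)]
  simpa using hN

/-- For `k = 2` the only central edge count is `j = 0`. [folklore] -/
theorem central_two_iff {n j : ℕ} : Central 2 n j ↔ j = 0 := by
  rw [Central, thr_two, Nat.cast_zero, sub_zero, Nat.abs_cast, Real.zero_rpow (by norm_num), Nat.cast_nonpos]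

/-- **`k = 2` cannot witness** (any `c`, any `δ ≥ 0`): the central window is the single slice `j = 0`, where
`x_e` is exact. [folklore] -/
theorem not_sliceLB_two (c : ℕ) {δ : ℝ} (hδ : 0 ≤ δ) : ¬ SliceLB c 2 δ := by
  intro H
  obtain ⟨n, hn, hn2⟩ := (H.and (eventually_ge_atTop 2)).exists
  obtain ⟨e₀⟩ := exists_edge hn2
  have hexact : ∀ x : Edge n → Bool, edgeCount x = 0 → (Circuit.input e₀).eval x = cliqueFn n 2 x := by
    intro x hx
    rw [eq_false_of_edgeCount_eq_zero hx, Circuit.eval_input, cliqueFn_false le_rfl]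
  have hlt := hn 0 (central_two_iff.2 rfl) (Circuit.input e₀) (input_isOver e₀ _)
    (by rw [errSet_eq_empty_of hexact, card_empty, Nat.cast_zero]; positivity)
  rw [Circuit.size_input] at hlt
  exact Nat.not_lt_zero _ hlt

/-- `thr 1 n = C(n,2)`: for `k = 1` the exponent `-2/(k-1)` is the junk value `-2/0 = 0`. [folklore] -/
theorem thr_one (n : ℕ) : thr 1 n = n.choose 2 := by
  rw [thr, Nat.cast_one, sub_self, div_zero, Real.rpow_zero, mul_one, Nat.floor_natCast]

/-- **`k = 1` cannot witness**: the central slice `j = C(n,2)` is `{K_n}`, where `x_e = 1 = CLIQUE_1`. [folklore] -/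
theorem not_sliceLB_one (c : ℕ) {δ : ℝ} (hδ : 0 ≤ δ) : ¬ SliceLB c 1 δ := by
  intro H
  obtain ⟨n, hn, hn2⟩ := (H.and (eventually_ge_atTop 2)).exists
  obtain ⟨e₀⟩ := exists_edge hn2
  have hexact : ∀ x : Edge n → Bool, edgeCount x = n.choose 2 →
      (Circuit.input e₀).eval x = cliqueFn n 1 x := by
    intro x hx
    rw [eq_true_of_edgeCount_eq hx, Circuit.eval_input, cliqueFn_true (by omega : 1 ≤ n)]
  have hc : Central 1 n (n.choose 2) := by rw [← thr_one n]; exact central_thr 1 n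
  have hlt := hn (n.choose 2) hc (Circuit.input e₀) (input_isOver e₀ _)
    (by rw [errSet_eq_empty_of hexact, card_empty, Nat.cast_zero]; positivity)
  rw [Circuit.size_input] at hlt
  exact Nat.not_lt_zero _ hlt

/-- `thr 0 n = C(n,2)·n²`: for `k = 0` the exponent is `-2/(0-1) = 2`. [folklore] -/
theorem thr_zero (n : ℕ) : thr 0 n = n.choose 2 * n ^ 2 := by
  rw [thr, Nat.cast_zero, zero_sub, show (-(2 : ℝ)) / (-1) = 2 by norm_num, Real.rpow_two]
  exact_mod_cast Nat.floor_natCast (R := ℝ) (n.choose 2 * n ^ 2)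

/-- **`k = 0` cannot witness** (any real `δ`): the central slice `j = C(n,2)·n² > C(n,2)` is EMPTY (`n ≥ 2`), so
every circuit is vacuously accurate there and `x_e` (no gates) violates the conclusion. [folklore] -/
theorem not_sliceLB_zero (c : ℕ) (δ : ℝ) : ¬ SliceLB c 0 δ := by
  intro H
  obtain ⟨n, hn, hn2⟩ := (H.and (eventually_ge_atTop 2)).exists
  obtain ⟨e₀⟩ := exists_edge hn2
  have hN : 0 < n.choose 2 := Nat.choose_pos hn2
  have hempty : #(slice n (thr 0 n)) = 0 := by
    refine card_slice_eq_zero ?_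
    rw [thr_zero]
    have h4 : 4 ≤ n ^ 2 := by nlinarith
    nlinarith
  have herr : (#(errSet n 0 (thr 0 n) (Circuit.input e₀)) : ℝ) ≤ δ * #(slice n (thr 0 n)) := by
    have h0 : #(errSet n 0 (thr 0 n) (Circuit.input e₀)) = 0 := by
      have hle := card_le_card (errSet_subset_slice n 0 (thr 0 n) (Circuit.input e₀))
      omega
    rw [h0, hempty, Nat.cast_zero, mul_zero]
  have hlt := hn (thr 0 n) (central_thr 0 n) (Circuit.input e₀) (input_isOver e₀ _) herr
  rw [Circuit.size_input] at hlt
  exact Nat.not_lt_zero _ hlt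

/-- **The guard `3 ≤ k` is redundant**: every `(k, δ)` with `δ ≥ 0` that satisfies the inner clause at any
exponent already has `k ≥ 3`. [folklore] -/
theorem three_le_of_sliceLB {c k : ℕ} {δ : ℝ} (hδ : 0 ≤ δ) (H : SliceLB c k δ) : 3 ≤ k := by
  by_contra hk
  interval_cases k
  · exact not_sliceLB_zero c δ H
  · exact not_sliceLB_one c hδ H
  · exact not_sliceLB_two c hδ H


/-! ## §2 Tightness of the witnesses `(k, δ)`: `c ≤ k + 1` and `δ ≤ 1/k!` are forced -/

/-- `C(k,2) + 1 ≤ k!` for `k ≥ 3` (`C(k,2) + 1 ≤ 2·C(k,2) ≤ k(k-1) ≤ k·(k-1)! = k!`). [folklore] -/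
theorem choose_two_succ_le_factorial {k : ℕ} (hk : 3 ≤ k) : k.choose 2 + 1 ≤ k.factorial := by
  have h1 : 1 ≤ k.choose 2 := Nat.choose_pos (by omega)
  have h2 : 2 * k.choose 2 ≤ k * (k - 1) := by
    rw [Nat.choose_two_right]
    exact Nat.mul_div_le (k * (k - 1)) 2
  have h3 : k * (k - 1) ≤ k.factorial := by
    rw [← Nat.mul_factorial_pred (by omega : k ≠ 0)]
    exact Nat.mul_le_mul_left k (Nat.self_le_factorial _)
  omega

/-- **The exact DNF is small**: `C(n,k)·(C(k,2)+1) ≤ C(n,k)·k! = n(n-1)⋯(n-k+1) ≤ n^k` (`k ≥ 3`). [folklore] -/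
theorem dnfSize_le_pow {n k : ℕ} (hk : 3 ≤ k) : n.choose k * (k.choose 2 + 1) ≤ n ^ k :=
  calc n.choose k * (k.choose 2 + 1) ≤ n.choose k * k.factorial :=
        Nat.mul_le_mul_left _ (choose_two_succ_le_factorial hk)
    _ = n.descFactorial k := by rw [mul_comm, Nat.descFactorial_eq_factorial_mul_choose]
    _ ≤ n ^ k := Nat.descFactorial_le_pow n k

/-- **Small `k` is refuted by brute force**: for `3 ≤ k ≤ c` and every `δ ≥ 0`, `SliceLB c k δ` is FALSE — the
exact monotone DNF (`≤ C(n,k)(C(k,2)+1) ≤ n^k ≤ n^c` gates) has error `0` on every slice. [folklore] -/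
theorem not_sliceLB_of_le {c k : ℕ} {δ : ℝ} (hk : 3 ≤ k) (hc : k ≤ c) (hδ : 0 ≤ δ) : ¬ SliceLB c k δ := by
  intro H
  obtain ⟨n, hn, hnk⟩ := (H.and (eventually_ge_atTop (k + 1))).exists
  obtain ⟨C, hCB, hs, he⟩ := exists_monotone_cliqueCircuit (n := n) (k := k) (by omega) (by omega)
  have hlt := hn (thr k n) (central_thr k n) C hCB
    (by rw [errSet_eq_empty_of fun x _ => he x, card_empty, Nat.cast_zero]; positivity)
  have h1 : C.size ≤ n ^ k := hs.trans (dnfSize_le_pow hk)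
  have h3 : n ^ k ≤ n ^ c := Nat.pow_le_pow_right (by omega) hc
  omega

/-- **Every witness has `k ≥ c + 1`**: the clique size must EXCEED the exponent (in truth `k ≳ 4c`, by Rossman's
`n^{k/4+O(1)}` average-case upper bound, FOCS'10 Thm 3 = `Rossman2010_upperBound` — not needed here). [folklore] -/
theorem exponent_lt_of_sliceLB {c k : ℕ} {δ : ℝ} (hk : 3 ≤ k) (hδ : 0 ≤ δ) (H : SliceLB c k δ) : c < k := by
  by_contra hc
  exact not_sliceLB_of_le hk (not_lt.1 hc) hδ H

/-- On slice `j ≤ C(n,2)` the graphs switching a fixed edge on are a `j/C(n,2)`-fraction (hypergeometric: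
`C(N-1,j-1)·N = C(N,j)·j`). [folklore] -/
theorem card_slice_filter_true_le {n j : ℕ} (e₀ : Edge n) (hj : j ≤ n.choose 2) :
    (#((slice n j).filter fun x => x e₀ = true) : ℝ) ≤ (j : ℝ) / n.choose 2 * #(slice n j) := by
  rcases Nat.eq_zero_or_pos j with rfl | hj0
  · have h0 : (slice n 0).filter (fun x => x e₀ = true) = ∅ := by
      refine filter_eq_empty_iff.2 fun x hx h => ?_
      have hx0 := eq_false_of_edgeCount_eq_zero (mem_filter.1 hx).2
      rw [hx0] at h
      exact Bool.false_ne_true h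
    rw [h0, card_empty, Nat.cast_zero]
    positivity
  · have hN : 0 < n.choose 2 := by omega
    have h1 : #((slice n j).filter fun x => x e₀ = true) ≤ (n.choose 2 - 1).choose (j - 1) := by
      have h := card_slice_supset_le (n := n) j ({e₀} : Finset (Edge n)) (by rw [card_singleton]; omega)
      rw [card_singleton] at h
      refine le_trans (le_of_eq ?_) h
      rw [Summit.PneNP.PneNP.Theorems.ConstantBand.Negative.slice, filter_filter]
      congr 1
      refine filter_congr fun x _ => ?_
      simp
    have h2 : (n.choose 2 - 1).choose (j - 1) * n.choose 2 ≤ (n.choose 2).choose j * j := by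
      simpa using choose_sub_mul_pow_le_choose_mul_pow (K := 1) hj0 hj
    rw [card_slice_eq_sliceCard, sliceCard_eq, div_mul_eq_mul_div, le_div_iff₀ (by exact_mod_cast hN)]
    calc (#((slice n j).filter fun x => x e₀ = true) : ℝ) * n.choose 2
        ≤ ((n.choose 2 - 1).choose (j - 1) : ℝ) * n.choose 2 := by
          exact_mod_cast Nat.mul_le_mul_right (n.choose 2) h1
      _ ≤ (n.choose 2).choose j * j := by exact_mod_cast h2
      _ = j * ((n.choose 2).choose j : ℕ) := mul_comm _ _

/-- The error set of the projection `x_{e₀}` on a slice: `x_{e₀} ≠ CLIQUE_k(x)` forces `x_{e₀} = 1` or a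
`k`-clique. [folklore] -/
theorem errSet_input_subset {n k j : ℕ} (e₀ : Edge n) :
    errSet n k j (Circuit.input e₀) ⊆ (slice n j).filter (fun x => x e₀ = true) ∪
      univ.filter (fun x : Edge n → Bool => edgeCount x = j ∧ cliqueFn n k x = true) := by
  intro x hx
  rw [errSet, mem_filter] at hx
  obtain ⟨-, hj, hne⟩ := hx
  rw [Circuit.eval_input] at hne
  have hxs : x ∈ slice n j := mem_filter.2 ⟨mem_univ _, hj⟩
  rw [mem_union, mem_filter, mem_filter]
  cases h0 : x e₀ with
  | true => exact Or.inl ⟨hxs, rfl⟩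
  | false =>
    refine Or.inr ⟨mem_univ _, hj, ?_⟩
    cases h1 : cliqueFn n k x with
    | true => rfl
    | false => exact absurd (h0.trans h1.symm) hne

/-- **First moment on a slice `j ≤ C(n,2)` at or below the real threshold `C(n,2)·n^{-2/(k-1)}`**: the graphs with
`x_{e₀} = 1` or a `k`-clique number at most `(j/C(n,2) + 1/k!)·#slice_j`. [folklore] -/
theorem card_onEdge_union_clique_le {n k j : ℕ} (hk : 2 ≤ k) (hn : 2 ≤ n) (e₀ : Edge n) (hjN : j ≤ n.choose 2)
    (hjT : (j : ℝ) ≤ (n.choose 2 : ℕ) * (n : ℝ) ^ (-(2 : ℝ) / ((k : ℝ) - 1))) :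
    (#((slice n j).filter (fun x => x e₀ = true) ∪
        univ.filter (fun x : Edge n → Bool => edgeCount x = j ∧ cliqueFn n k x = true)) : ℝ) ≤
      ((j : ℝ) / n.choose 2 + 1 / k.factorial) * #(slice n j) := by
  have hA := card_slice_filter_true_le e₀ hjN
  have hB : (#(univ.filter fun x : Edge n → Bool => edgeCount x = j ∧ cliqueFn n k x = true) : ℝ) ≤
      1 / k.factorial * #(slice n j) := by
    by_cases hKj : k.choose 2 ≤ j
    · exact firstMoment_slice (n := n) hk (by omega) hKj hjN hjT
    · have h0 : univ.filter (fun x : Edge n → Bool => edgeCount x = j ∧ cliqueFn n k x = true) = ∅ :=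
        filter_eq_empty_iff.2 fun x _ hx => hKj (hx.1 ▸ choose_le_edgeCount_of_cliqueFn hx.2)
      rw [h0, card_empty, Nat.cast_zero]
      positivity
  calc (#((slice n j).filter (fun x => x e₀ = true) ∪
          univ.filter (fun x : Edge n → Bool => edgeCount x = j ∧ cliqueFn n k x = true)) : ℝ)
      ≤ (#((slice n j).filter fun x => x e₀ = true) : ℝ) +
          #(univ.filter fun x : Edge n → Bool => edgeCount x = j ∧ cliqueFn n k x = true) := by
        exact_mod_cast card_union_le _ _
    _ ≤ (j : ℝ) / n.choose 2 * #(slice n j) + 1 / k.factorial * #(slice n j) := add_le_add hA hB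
    _ = ((j : ℝ) / n.choose 2 + 1 / k.factorial) * #(slice n j) := by ring

/-- **First-moment bound for `x_{e₀}`** on a slice `j ≤ C(n,2)` at or below the real threshold:
`#err_j(x_{e₀}) ≤ (j/C(n,2) + 1/k!)·#slice_j`. [folklore] -/
theorem card_errSet_input_le {n k j : ℕ} (hk : 2 ≤ k) (hn : 2 ≤ n) (e₀ : Edge n) (hjN : j ≤ n.choose 2)
    (hjT : (j : ℝ) ≤ (n.choose 2 : ℕ) * (n : ℝ) ^ (-(2 : ℝ) / ((k : ℝ) - 1))) :
    (#(errSet n k j (Circuit.input e₀)) : ℝ) ≤ ((j : ℝ) / n.choose 2 + 1 / k.factorial) * #(slice n j) :=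
  le_trans (by exact_mod_cast card_le_card (errSet_input_subset e₀)) (card_onEdge_union_clique_le hk hn e₀ hjN hjT)

/-- **The δ-floor.** For `k ≥ 2` and ANY exponent `c`: if `δ > 1/k!` then `SliceLB c k δ` is false — on the
central slice `j = m_k(n)` the gate-free circuit `x_{e₀}` errs on at most `(m_k(n)/C(n,2) + 1/k!)·#slice`
graphs and `m_k(n)/C(n,2) ≤ n^{-2/(k-1)} → 0`. [folklore] -/
theorem not_sliceLB_of_factorial_inv_lt {c k : ℕ} {δ : ℝ} (hk : 2 ≤ k) (hδ : 1 / (k.factorial : ℝ) < δ) :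
    ¬ SliceLB c k δ := by
  intro H
  have hε : 0 < δ - 1 / k.factorial := sub_pos.2 hδ
  have hev : ∀ᶠ n : ℕ in atTop, pc n k < δ - 1 / k.factorial :=
    (tendsto_pc hk).eventually (gt_mem_nhds hε)
  obtain ⟨n, hn, hpn, hn2⟩ := (H.and (hev.and (eventually_ge_atTop 2))).exists
  obtain ⟨e₀⟩ := exists_edge hn2
  have hN : 0 < n.choose 2 := Nat.choose_pos hn2
  have hjT : (thr k n : ℝ) ≤ (n.choose 2 : ℕ) * (n : ℝ) ^ (-(2 : ℝ) / ((k : ℝ) - 1)) :=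
    Nat.floor_le (by positivity)
  have hjN : thr k n ≤ n.choose 2 := mk_le_choose (by omega) hk
  have hratio : (thr k n : ℝ) / n.choose 2 ≤ pc n k := by
    rw [div_le_iff₀ (by exact_mod_cast hN), pc, mul_comm]
    exact hjT
  have herr : (#(errSet n k (thr k n) (Circuit.input e₀)) : ℝ) ≤ δ * #(slice n (thr k n)) :=
    (card_errSet_input_le hk hn2 e₀ hjN hjT).trans
      (mul_le_mul_of_nonneg_right (by linarith) (Nat.cast_nonneg _))
  have hlt := hn (thr k n) (central_thr k n) (Circuit.input e₀) (input_isOver e₀ _) herr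
  rw [Circuit.size_input] at hlt
  exact Nat.not_lt_zero _ hlt

/-- **Every witness has `δ ≤ 1/k!`** — the accuracy demanded must shrink factorially in `k` (the true floor
for near-constant circuits is `1 - e^{-1/k!}`, second moment; not needed here). [folklore] -/
theorem delta_le_of_sliceLB {c k : ℕ} {δ : ℝ} (hk : 2 ≤ k) (H : SliceLB c k δ) : δ ≤ 1 / (k.factorial : ℝ) :=
  le_of_not_gt fun h => not_sliceLB_of_factorial_inv_lt hk h H

/-- **Shape of every witness** `(k, δ)` of the crux at exponent `c`: `k ≥ c + 1` AND `δ ≤ 1/k!` — so a proof of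
`SliceTarget` at exponent `c` is a statement about `(c+1)!^{-1}`-accurate circuits at the least. [folklore] -/
theorem witness_shape {c k : ℕ} {δ : ℝ} (hk : 3 ≤ k) (hδ : 0 ≤ δ) (H : SliceLB c k δ) :
    c < k ∧ δ ≤ 1 / (k.factorial : ℝ) :=
  ⟨exponent_lt_of_sliceLB hk hδ H, delta_le_of_sliceLB (by omega) H⟩

/-! ## §3 Natural strengthenings (quantifier orders) refuted -/

/-- **"One `k` for every `c`" is FALSE** (exact DNF at `c = k`). [folklore] -/
theorem not_sliceTargetKFirst : ¬ ∃ k : ℕ, 3 ≤ k ∧ ∀ c : ℕ, ∃ δ : ℝ, 0 < δ ∧ SliceLB c k δ := by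
  rintro ⟨k, hk, h⟩
  obtain ⟨δ, hδ, H⟩ := h k
  exact not_sliceLB_of_le hk le_rfl hδ.le H

/-- **"Every `k ≥ 3` works" is FALSE** (`k = 3`, `c = 3`: the exact triangle DNF has `≤ 4·C(n,3) ≤ n^3` gates). [folklore] -/
theorem not_sliceTargetForallK : ¬ ∀ c : ℕ, ∀ k : ℕ, 3 ≤ k → ∃ δ : ℝ, 0 < δ ∧ SliceLB c k δ := by
  intro h
  obtain ⟨δ, hδ, H⟩ := h 3 3 le_rfl
  exact not_sliceLB_of_le le_rfl le_rfl hδ.le H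

/-- If `k > ⌈1/δ⌉₊ + 1` then `1/k! < δ` (strictly). [folklore] -/
theorem factorial_inv_lt_of_lt {δ : ℝ} (hδ : 0 < δ) {k : ℕ} (hk : ⌈1 / δ⌉₊ + 1 < k) :
    1 / (k.factorial : ℝ) < δ := by
  have h1 : 1 / ((k - 1).factorial : ℝ) ≤ δ := factorial_inv_le_of_ceil_lt hδ (by omega)
  have h2 : ((k - 1).factorial : ℝ) < k.factorial := by
    exact_mod_cast (Nat.factorial_lt (by omega : 0 < k - 1)).2 (by omega)
  have h3 : 1 / (k.factorial : ℝ) < 1 / ((k - 1).factorial : ℝ) :=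
    one_div_lt_one_div_of_lt (by positivity) h2
  exact h3.trans_le h1

/-- **"`δ` before `k`" is FALSE**: the quantifier order `∃ δ > 0, ∀ c, ∃ k ≥ 3` fails — given `δ`, at
`c = ⌈1/δ⌉₊ + 2` a witness `k ≤ c` dies by the exact DNF (§2) and a witness `k ≥ c + 1 = ⌈1/δ⌉₊ + 3` has
`1/k! < δ` and dies by the gate-free circuit `x_e` (δ-floor). The crux's `δ = δ(c)` must tend to `0`. [folklore] -/
theorem not_sliceTargetDeltaFirst : ¬ ∃ δ : ℝ, 0 < δ ∧ ∀ c : ℕ, ∃ k : ℕ, 3 ≤ k ∧ SliceLB c k δ := by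
  rintro ⟨δ, hδ, h⟩
  obtain ⟨k, hk, H⟩ := h (⌈1 / δ⌉₊ + 2)
  by_cases hkc : k ≤ ⌈1 / δ⌉₊ + 2
  · exact not_sliceLB_of_le hk hkc hδ.le H
  · exact not_sliceLB_of_factorial_inv_lt (by omega) (factorial_inv_lt_of_lt hδ (by omega)) H

/-! ## §4 X is a statement about GENERAL circuits (Berkowitz on one slice, kernel-checked)

`SliceTargetB2` is the crux with `{∧₂, ∨₂}` replaced by the full binary basis `B₂` (all sixteen fan-in-2 gates,
constants, negation). `sliceTarget_iff_B2`: modulo the route's support item `SliceMonotonization` (Berkowitz's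
pseudo-complements; PROVED in tree as `Summit.PneNP.PneNP.Theorems.sliceMonotonization_proof`, taken here as a
hypothesis so that this file does not depend on that module) the two are EQUIVALENT. So a kill of X may use
negations freely: X is refuted by ONE exponent `c` such that for every `k` general size-`n^c` circuits
`δ`-approximate `k`-CLIQUE on a central slice for every `δ > 0` — a fixed-exponent average-case clique
algorithm at criticality — and by nothing weaker. -/

/-- The crux's inner clause over an arbitrary gate basis `B`. [folklore] -/
def SliceLBOver (B : Set GateFn) (c k : ℕ) (δ : ℝ) : Prop :=
  ∀ᶠ n : ℕ in atTop, ∀ j : ℕ, Central k n j → ∀ C : Circuit (Edge n), C.IsOver B →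
    (#(errSet n k j C) : ℝ) ≤ δ * #(slice n j) → n ^ c < C.size

/-- Over `{∧₂, ∨₂}` this is `SliceLB`. [folklore] -/
theorem sliceLBOver_monotone_iff {c k : ℕ} {δ : ℝ} : SliceLBOver monotoneBasis c k δ ↔ SliceLB c k δ := Iff.rfl

/-- A larger basis gives a stronger lower-bound claim. [folklore] -/
theorem SliceLBOver.anti_basis {B B' : Set GateFn} {c k : ℕ} {δ : ℝ} (h : B ⊆ B') (H : SliceLBOver B' c k δ) :
    SliceLBOver B c k δ := by
  filter_upwards [H] with n hn j hj C hC herr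
  exact hn j hj C (hC.mono h) herr

/-- The crux over the full binary basis `B₂` (general fan-in-2 circuits). [folklore] -/
def SliceTargetB2 : Prop :=
  ∀ c : ℕ, ∃ k : ℕ, 3 ≤ k ∧ ∃ δ : ℝ, 0 < δ ∧ SliceLBOver B2 c k δ

/-- `{∧₂, ∨₂} ⊆ B₂`. [folklore] -/
theorem monotoneBasis_subset_B2 : monotoneBasis ⊆ B2 :=
  monotoneBasis_subset_deMorgan.trans deMorganBasis_subset_B2

/-- `n^{-1} ≤ n^{-2/(k-1)}` for `k ≥ 3`. [folklore] -/
theorem inv_le_rpow_threshold {k n : ℕ} (hk : 3 ≤ k) (hn : 1 ≤ n) :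
    (n : ℝ)⁻¹ ≤ (n : ℝ) ^ (-(2 : ℝ) / ((k : ℝ) - 1)) := by
  have hn1 : (1 : ℝ) ≤ n := by exact_mod_cast hn
  rw [← Real.rpow_neg_one]
  apply Real.rpow_le_rpow_of_exponent_le hn1
  have hk' : (3 : ℝ) ≤ k := by exact_mod_cast hk
  rw [neg_div, neg_le_neg_iff, div_le_one (by linarith)]
  linarith

/-- **The threshold edge count is unbounded**: `m_k(n) ≥ (n-1)/2 - 1` for `k ≥ 3`. [folklore] -/
theorem thr_ge {k n : ℕ} (hk : 3 ≤ k) (hn : 1 ≤ n) : ((n : ℝ) - 1) / 2 - 1 ≤ thr k n := by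
  have hT : ((n : ℝ) - 1) / 2 ≤ (n.choose 2 : ℕ) * (n : ℝ) ^ (-(2 : ℝ) / ((k : ℝ) - 1)) := by
    have hn0 : (n : ℝ) ≠ 0 := by exact_mod_cast (show n ≠ 0 by omega)
    calc ((n : ℝ) - 1) / 2 = (n.choose 2 : ℕ) * (n : ℝ)⁻¹ := by
          rw [Nat.cast_choose_two]; field_simp
      _ ≤ _ := mul_le_mul_of_nonneg_left (inv_le_rpow_threshold hk hn) (Nat.cast_nonneg _)
  have hfl := Nat.lt_floor_add_one (((n.choose 2 : ℕ) : ℝ) * (n : ℝ) ^ (-(2 : ℝ) / ((k : ℝ) - 1)))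
  rw [thr]
  linarith

/-- Central edge counts lie in `[m - m^{3/4}, 2m]` once `m = m_k(n) ≥ 1`. [folklore] -/
theorem central_bounds {k n j : ℕ} (hj : Central k n j) (h1 : 1 ≤ thr k n) :
    (thr k n : ℝ) - (thr k n : ℝ) ^ ((3 : ℝ) / 4) ≤ j ∧ (j : ℝ) ≤ 2 * thr k n := by
  have hpow : (thr k n : ℝ) ^ ((3 : ℝ) / 4) ≤ thr k n := by
    have h1' : (1 : ℝ) ≤ thr k n := by exact_mod_cast h1
    calc (thr k n : ℝ) ^ ((3 : ℝ) / 4) ≤ (thr k n : ℝ) ^ (1 : ℝ) :=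
          Real.rpow_le_rpow_of_exponent_le h1' (by norm_num)
      _ = thr k n := Real.rpow_one _
  obtain ⟨hlo, hhi⟩ := abs_sub_le_iff.1 hj
  constructor <;> linarith

/-- A central edge count is positive once `m_k(n) ≥ 2` (`|0 - m| ≤ m^{3/4}` forces `m ≤ 1`). [folklore] -/
theorem pos_of_central {k n j : ℕ} (hj : Central k n j) (h2 : 2 ≤ thr k n) : 0 < j := by
  by_contra hj0
  obtain rfl : j = 0 := by omega
  rw [Central, Nat.cast_zero, zero_sub, abs_neg, Nat.abs_cast] at hj
  have h2' : (1 : ℝ) < thr k n := by exact_mod_cast h2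
  have hlt : (thr k n : ℝ) ^ ((3 : ℝ) / 4) < (thr k n : ℝ) ^ (1 : ℝ) :=
    Real.rpow_lt_rpow_of_exponent_lt h2' (by norm_num)
  rw [Real.rpow_one] at hlt
  linarith

/-- **Eventually every central `j` satisfies `0 < j < C(n,2)`** (`k ≥ 3`): the hypotheses of
`SliceMonotonization` hold on the whole window. [folklore] -/
theorem eventually_central_pos_lt {k : ℕ} (hk : 3 ≤ k) :
    ∀ᶠ n : ℕ in atTop, ∀ j : ℕ, Central k n j → 0 < j ∧ j < n.choose 2 := by
  have hpc : ∀ᶠ n : ℕ in atTop, pc n k < 1 / 2 :=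
    (tendsto_pc (by omega)).eventually (gt_mem_nhds (by norm_num))
  filter_upwards [hpc, eventually_ge_atTop 7] with n hp hn j hj
  have hthr : (2 : ℝ) ≤ thr k n := by
    have h := thr_ge hk (by omega : 1 ≤ n)
    have h7 : (7 : ℝ) ≤ n := by exact_mod_cast hn
    linarith
  have hthr' : 2 ≤ thr k n := by exact_mod_cast hthr
  refine ⟨pos_of_central hj hthr', ?_⟩
  have hjle := (central_bounds hj (by omega)).2
  have hT : (thr k n : ℝ) ≤ (n.choose 2 : ℕ) * pc n k := by
    rw [pc]; exact Nat.floor_le (by positivity)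
  have hN : (0 : ℝ) < (n.choose 2 : ℕ) := by exact_mod_cast Nat.choose_pos (by omega)
  have hlt : (j : ℝ) < n.choose 2 := by nlinarith
  exact_mod_cast hlt

/-- Size bookkeeping: `c₀(n^c + n^{c₀}) < n^{c+c₀+1}` for `n > 2c₀`. [folklore] -/
theorem eventually_monotonization_small (c c₀ : ℕ) :
    ∀ᶠ n : ℕ in atTop, c₀ * (n ^ c + n ^ c₀) < n ^ (c + c₀ + 1) := by
  filter_upwards [eventually_gt_atTop (2 * c₀)] with n hn
  have hn1 : 1 ≤ n := by omega
  have h1 : n ^ c ≤ n ^ (c + c₀) := Nat.pow_le_pow_right hn1 (by omega)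
  have h2 : n ^ c₀ ≤ n ^ (c + c₀) := Nat.pow_le_pow_right hn1 (by omega)
  have hX : 0 < n ^ (c + c₀) := Nat.pow_pos hn1
  have h3 : n ^ (c + c₀ + 1) = n ^ (c + c₀) * n := pow_succ _ _
  rw [h3]
  nlinarith

/-- **X ⟹ its general-circuit form** (modulo Berkowitz's monotonization with constant `c₀`): a `B₂`-circuit of
size `≤ n^c`, `δ`-accurate on a central slice `j` (`0 < j < C(n,2)` eventually), monotonizes to a `{∧₂,∨₂}`-circuit
with the SAME error set and `≤ c₀(n^c + n^{c₀}) < n^{c+c₀+1}` gates, contradicting X at exponent `c + c₀ + 1`. [folklore] -/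
theorem sliceTargetB2_of_sliceTarget (hM : SliceMonotonization) (hT : SliceTarget) : SliceTargetB2 := by
  intro c
  obtain ⟨c₀, hc₀⟩ := hM
  obtain ⟨k, hk, δ, hδ, H⟩ := (sliceTarget_iff.1 hT) (c + c₀ + 1)
  refine ⟨k, hk, δ, hδ, ?_⟩
  filter_upwards [H, eventually_central_pos_lt hk, eventually_monotonization_small c c₀] with n hn hcen hsm j hj
    C hCB herr
  obtain ⟨hj0, hjN⟩ := hcen j hj
  by_contra hsize
  obtain ⟨C', hC'B, hC's, hC'e⟩ := hc₀ n j C hCB hj0 hjN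
  have herr' : (#(errSet n k j C') : ℝ) ≤ δ * #(slice n j) := by
    rwa [errSet_congr (C := C) (C' := C') fun x hx => hC'e x hx]
  have hlt := hn j hj C' hC'B herr'
  have hle : C'.size ≤ c₀ * (n ^ c + n ^ c₀) :=
    hC's.trans (Nat.mul_le_mul_left _ (Nat.add_le_add_right (not_lt.1 hsize) _))
  omega

/-- **`SliceTarget ↔ SliceTargetB2`** (modulo `SliceMonotonization`, proved in tree): on one slice, syntactic
monotonicity costs only a polynomial, so X is a fixed-polynomial AVERAGE-CASE lower bound for GENERAL circuits
computing the P-functions `CLIQUE_k` on the critical slice. [folklore] -/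
theorem sliceTarget_iff_B2 (hM : SliceMonotonization) : SliceTarget ↔ SliceTargetB2 := by
  refine ⟨sliceTargetB2_of_sliceTarget hM, fun h c => ?_⟩
  -- trivial direction: a lower bound against `B₂`-circuits is one against `{∧₂, ∨₂}`-circuits
  obtain ⟨k, hk, δ, hδ, H⟩ := h c
  exact ⟨k, hk, δ, hδ, H.anti_basis monotoneBasis_subset_B2⟩

/-- **What a kill may use**: negations. Modulo `SliceMonotonization`, X is refuted by one exponent `c` with,
for every `k ≥ 3` and `δ > 0`, infinitely many `n` carrying a GENERAL `B₂`-circuit of size `≤ n^c` that is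
`δ`-accurate for `CLIQUE_k` on some central slice. [folklore] -/
theorem not_sliceTarget_of_B2_kill (hM : SliceMonotonization)
    (h : ∃ c : ℕ, ∀ k : ℕ, 3 ≤ k → ∀ δ : ℝ, 0 < δ → ∃ᶠ n : ℕ in atTop, ∃ j : ℕ, Central k n j ∧
      ∃ C : Circuit (Edge n), C.IsOver B2 ∧ (#(errSet n k j C) : ℝ) ≤ δ * #(slice n j) ∧ C.size ≤ n ^ c) :
    ¬ SliceTarget := by
  intro hT
  obtain ⟨c, hc⟩ := h
  obtain ⟨k, hk, δ, hδ, H⟩ := sliceTargetB2_of_sliceTarget hM hT c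
  have hfr := hc k hk δ hδ
  have : ∃ᶠ n : ℕ in atTop, False := by
    refine (hfr.and_eventually H).mono ?_
    rintro n ⟨⟨j, hj, C, hCB, herr, hs⟩, hn⟩
    exact absurd (hn j hj C hCB herr) (not_lt.2 hs)
  exact frequently_false _ this

/-! ### §4b Unconditionally: `SliceMonotonization` is a tree theorem (`sliceMonotonization_proof`, item 2836, p78537) -/

/-- **`SliceTarget ↔ SliceTargetB2`, unconditionally** (Berkowitz's monotonization is proved in tree). [folklore] -/
theorem sliceTarget_iff_B2_holds : SliceTarget ↔ SliceTargetB2 :=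
  sliceTarget_iff_B2 Summit.PneNP.PneNP.Theorems.sliceMonotonization_proof

/-- **Kill transfer, unconditionally**: small accurate GENERAL circuits on central slices for every `k, δ` refute X. [folklore] -/
theorem not_sliceTarget_of_B2_kill_holds
    (h : ∃ c : ℕ, ∀ k : ℕ, 3 ≤ k → ∀ δ : ℝ, 0 < δ → ∃ᶠ n : ℕ in atTop, ∃ j : ℕ, Central k n j ∧
      ∃ C : Circuit (Edge n), C.IsOver B2 ∧ (#(errSet n k j C) : ℝ) ≤ δ * #(slice n j) ∧ C.size ≤ n ^ c) :
    ¬ SliceTarget :=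
  not_sliceTarget_of_B2_kill Summit.PneNP.PneNP.Theorems.sliceMonotonization_proof h

/-- **The general-circuit kill shape, as an equivalence**: `¬X` iff ONE exponent `c` admits, for every `k ≥ 3` and
`δ > 0`, infinitely often a `B₂`-circuit of size `≤ n^c` that is `δ`-accurate for `CLIQUE_k` on a central slice. [folklore] -/
theorem not_sliceTarget_iff_B2 :
    ¬ SliceTarget ↔ ∃ c : ℕ, ∀ k : ℕ, 3 ≤ k → ∀ δ : ℝ, 0 < δ → ∃ᶠ n : ℕ in atTop, ∃ j : ℕ, Central k n j ∧
      ∃ C : Circuit (Edge n), C.IsOver B2 ∧ (#(errSet n k j C) : ℝ) ≤ δ * #(slice n j) ∧ C.size ≤ n ^ c := by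
  constructor
  · intro h
    obtain ⟨c, hc⟩ := not_sliceTarget_iff.1 h
    refine ⟨c, fun k hk δ hδ => (hc k hk δ hδ).mono ?_⟩
    rintro n ⟨j, hj, C, hCB, herr, hs⟩
    exact ⟨j, hj, C, hCB.mono monotoneBasis_subset_B2, herr, hs⟩
  · exact not_sliceTarget_of_B2_kill_holds

/-! ## §5 Weakenings of X that still feed the route's assembly (information for the planner)

The assembly (item 10382) consumes X only at `j = m_k(n)`, with error EXACTLY `0` (the monotonized P/poly circuit is
exact on the slice), and at ONE large `n` per `(c, k)`. Hence each of the following is implied by X, and each still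
closes the route with the same glue: `SliceTargetExact` (worst case on the slice: `δ = 0`), `SliceTargetIO`
(`∃ᶠ n` in place of `∀ᶠ n` — infinitely-often hardness suffices against the EVENTUAL upper bound from `NP ⊆ P/poly`),
and their conjunction-free combination `SliceTargetExactIO`. None of them is refuted here (each implies `NP ⊄ P/poly`
through the assembly); they are recorded because a proof attempt may find the weaker targets easier to state
closure lemmas for, and because a refutation of X that does not refute `SliceTargetExactIO` would leave the route
repairable. -/

/-- The worst-case (exact-on-the-slice) inner clause. [folklore] -/
def SliceLBExact (c k : ℕ) : Prop :=
  ∀ᶠ n : ℕ in atTop, ∀ j : ℕ, Central k n j → ∀ C : Circuit (Edge n), C.IsOver monotoneBasis →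
    (∀ x : Edge n → Bool, edgeCount x = j → C.eval x = cliqueFn n k x) → n ^ c < C.size

/-- X with `δ = 0`: the central-slice functions of `CLIQUE_{k(c)}` have monotone (= general) circuit complexity
`> n^c` for all large `n`. [folklore] -/
def SliceTargetExact : Prop := ∀ c : ℕ, ∃ k : ℕ, 3 ≤ k ∧ SliceLBExact c k

/-- `δ`-accuracy lower bounds contain the exact lower bound. [folklore] -/
theorem sliceLBExact_of_sliceLB {c k : ℕ} {δ : ℝ} (hδ : 0 ≤ δ) (H : SliceLB c k δ) : SliceLBExact c k := by
  filter_upwards [H] with n hn j hj C hC hex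
  exact hn j hj C hC (by rw [errSet_eq_empty_of hex, card_empty, Nat.cast_zero]; positivity)

/-- X implies its worst-case form. [folklore] -/
theorem sliceTargetExact_of_sliceTarget (h : SliceTarget) : SliceTargetExact := fun c => by
  obtain ⟨k, hk, δ, hδ, H⟩ := sliceTarget_iff.1 h c
  exact ⟨k, hk, sliceLBExact_of_sliceLB hδ.le H⟩

/-- X with `∀ᶠ n` weakened to `∃ᶠ n` (infinitely-often hardness). [folklore] -/
def SliceTargetIO : Prop :=
  ∀ c : ℕ, ∃ k : ℕ, 3 ≤ k ∧ ∃ δ : ℝ, 0 < δ ∧ ∃ᶠ n : ℕ in atTop, ∀ j : ℕ, Central k n j →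
    ∀ C : Circuit (Edge n), C.IsOver monotoneBasis → (#(errSet n k j C) : ℝ) ≤ δ * #(slice n j) → n ^ c < C.size

/-- X implies its infinitely-often form. [folklore] -/
theorem sliceTargetIO_of_sliceTarget (h : SliceTarget) : SliceTargetIO := fun c => by
  obtain ⟨k, hk, δ, hδ, H⟩ := sliceTarget_iff.1 h c
  exact ⟨k, hk, δ, hδ, H.frequently⟩

/-- The weakest form along both axes: exact on the slice, infinitely often in `n`. [folklore] -/
def SliceTargetExactIO : Prop :=
  ∀ c : ℕ, ∃ k : ℕ, 3 ≤ k ∧ ∃ᶠ n : ℕ in atTop, ∀ j : ℕ, Central k n j →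
    ∀ C : Circuit (Edge n), C.IsOver monotoneBasis →
      (∀ x : Edge n → Bool, edgeCount x = j → C.eval x = cliqueFn n k x) → n ^ c < C.size

/-- X implies the weakest form. [folklore] -/
theorem sliceTargetExactIO_of_sliceTarget (h : SliceTarget) : SliceTargetExactIO := fun c => by
  obtain ⟨k, hk, H⟩ := sliceTargetExact_of_sliceTarget h c
  exact ⟨k, hk, H.frequently⟩

/-- **The minimal form the route actually consumes**: exact on the CENTRAL slice `j = m_k(n)` only, infinitely often in `n`
(drops the average case, the almost-everywhere, and the uniformity over the window). [folklore] -/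
def SliceTargetMin : Prop :=
  ∀ c : ℕ, ∃ k : ℕ, 3 ≤ k ∧ ∃ᶠ n : ℕ in atTop, ∀ C : Circuit (Edge n), C.IsOver monotoneBasis →
    (∀ x : Edge n → Bool, edgeCount x = thr k n → C.eval x = cliqueFn n k x) → n ^ c < C.size

/-- X implies the minimal form (so a refutation of X that spares `SliceTargetMin` leaves the route repairable by
restating X; conversely `SliceTargetMin` is what `Assembly` needs: `SliceMonotonization` at `M = m_k(n)` and the eventual
P/poly circuits meet an infinitely-often lower bound just as well). [folklore] -/
theorem sliceTargetMin_of_sliceTarget (h : SliceTarget) : SliceTargetMin := fun c => by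
  obtain ⟨k, hk, H⟩ := sliceTargetExactIO_of_sliceTarget h c
  exact ⟨k, hk, H.mono fun n hn C hC hex => hn (thr k n) (central_thr k n) C hC hex⟩

/-- Even the weakest form refutes small `k`: `k ≤ c` is impossible in `SliceTargetExactIO` too (the exact DNF
exists at EVERY large `n`). [folklore] -/
theorem exactIO_exponent_lt {c k : ℕ} (hk : 3 ≤ k)
    (H : ∃ᶠ n : ℕ in atTop, ∀ j : ℕ, Central k n j → ∀ C : Circuit (Edge n), C.IsOver monotoneBasis →
      (∀ x : Edge n → Bool, edgeCount x = j → C.eval x = cliqueFn n k x) → n ^ c < C.size) :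
    c < k := by
  by_contra hc
  have hev : ∀ᶠ n : ℕ in atTop, ¬ ∀ j : ℕ, Central k n j → ∀ C : Circuit (Edge n), C.IsOver monotoneBasis →
      (∀ x : Edge n → Bool, edgeCount x = j → C.eval x = cliqueFn n k x) → n ^ c < C.size := by
    filter_upwards [eventually_ge_atTop (k + 1)] with n hnk hall
    obtain ⟨C, hCB, hs, he⟩ := exists_monotone_cliqueCircuit (n := n) (k := k) (by omega) (by omega)
    have hlt := hall (thr k n) (central_thr k n) C hCB fun x _ => he x
    have h1 : C.size ≤ n ^ k := hs.trans (dnfSize_le_pow hk)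
    have h3 : n ^ k ≤ n ^ c := Nat.pow_le_pow_right (by omega) (not_lt.1 hc)
    omega
  exact H hev


/-! ## §6 Line `Sketch-ideator3-r1` (picked 06:18Z) — Targets: the guards of stub T3, the shape of the open stub T7

Stub-by-stub read (skeleton `Cruxes/SliceTarget/Lines/Sketch_ideator3_r1.lean`): T1 `SliceTouch`, T2 `FibreMin`, T4
`FibreCliqueUpper` (fine already at `k = 3`: first moment `≤ 1/6 + o(1) < 1/2`), T5 `CoincidenceTail2` (true with room: on the
critical slice `ω_k → Poisson(λ)`, `λ = 1/k!`, and `lim P[ω_k ≥ 2] = 1 - e^{-λ}(1+λ) < λ²/2`), T6 `Transfer` — all TRUE, and T1,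
T2, T5, T6 are landed (`OneSliceSliceTarget{SliceTouch,FibreMin,CoincidenceTail2,Transfer}.lean`); joint sufficiency IS T6,
kernel-checked. T3 `FibreCliqueLower` is true for `k ≥ 4` and BOTH its guards are load-bearing — `4 ≤ k`
(`fibreCliqueLower_false_at_three`) and the cap `#F ≤ 3n` (`fibreCliqueLower_false_uncapped`, every `k`): one mechanism,
`not_fibreCliqueLowerWith_of_frequently` — whenever the cap admits `#F = m_k(n)`, the fibre through a slice point `x₀` over its
own support `F = supp x₀` is `{x₀}` and `x₀ ∖ F = ∅` has no clique. T7 `ParitySliceHardFrom2` (OPEN) is crux-strength and NOT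
refuted; its witnesses obey the same shape as X's (`k ≥ c + 1`: `not_parityLB_of_le`, needs T5; `δ ≤ 1/k!`:
`not_parityLB_of_factorial_inv_lt`), and it is formally STRONGER than the conjunct `X(≥ 2)` it replaces by exactly the unforced
constant: `parityLB_of_sliceLB` — X at `(c, k, δ_X)` with `δ_X > δ + (1/k!)²/2` gives T7's clause at `(c, k, δ)`, so
`parityFrom2_of_sliceTarget_large`: X(≥2) WITH witnesses `δ_X > (3/2)(1/k!)²` implies T7, while X alone (whose `δ_X` may be
smaller, §2 only forces `δ_X ≤ 1/k!`) does not visibly do so; conversely T7 ⟹ X(≥2) is the line's `sliceLB_of_parity`. -/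

section Line

open Summit.PneNP.PneNP.Theorems.SliceACZero.Negative renaming supp → esupp, mem_supp → mem_esupp, card_supp → card_esupp,
  supp_injective → esupp_injective
open Summit.PneNP.PneNP.Theorems.SingleThreshold.Negative (zeroOn)

/-! ### T3 `FibreCliqueLower`: the guards `4 ≤ k` and `#F ≤ 3n` are load-bearing -/

/-- T3's clause at clique size `k` with a cap `B n` on the slot set: `∃ α > 0`, eventually, on every central slice, every
fibre over every `F` with `#F ≤ B n` has an `α`-fraction of graphs with a `k`-clique avoiding `F`
(T3 = `∀ k ≥ 4, FibreCliqueLowerWith k (3·)`). [folklore] -/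
def FibreCliqueLowerWith (k : ℕ) (B : ℕ → ℕ) : Prop :=
  ∃ α : ℝ, 0 < α ∧ ∀ᶠ n : ℕ in atTop, ∀ j : ℕ, Central k n j →
    ∀ F : Finset (Edge n), #F ≤ B n → ∀ ρ : Edge n → Bool,
      α * #((slice n j).filter fun x => ∀ e ∈ F, x e = ρ e) ≤
        #((slice n j).filter fun x => (∀ e ∈ F, x e = ρ e) ∧ cliqueFn n k (zeroOn F x) = true)

/-- If `F` contains every on-edge of `x₀ ∈ slice_j`, the fibre of slice `j` over `F` through `x₀` is `{x₀}`. [folklore] -/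
theorem fibre_eq_singleton {n j : ℕ} {x₀ : Edge n → Bool} (hx₀ : x₀ ∈ slice n j) {F : Finset (Edge n)}
    (hF : esupp x₀ ⊆ F) : ((slice n j).filter fun x => ∀ e ∈ F, x e = x₀ e) = {x₀} := by
  ext x
  simp only [mem_filter, mem_singleton]
  constructor
  · rintro ⟨hx, hagree⟩
    have hj : edgeCount x = edgeCount x₀ := by
      rw [(mem_filter.1 hx).2, (mem_filter.1 hx₀).2]
    have hsub : esupp x₀ ⊆ esupp x := fun e he => by
      rw [mem_esupp] at he ⊢
      rw [hagree e (hF (mem_esupp.2 he))]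
      exact he
    have heq : esupp x₀ = esupp x :=
      eq_of_subset_of_card_le hsub (by rw [card_esupp, card_esupp, hj])
    exact esupp_injective heq.symm
  · rintro rfl
    exact ⟨hx₀, fun e _ => rfl⟩

/-- … and `x₀ ∖ F` is the empty graph. [folklore] -/
theorem zeroOn_eq_false_of_supp_subset {n : ℕ} {x₀ : Edge n → Bool} {F : Finset (Edge n)} (hF : esupp x₀ ⊆ F) :
    zeroOn F x₀ = fun _ => false := by
  funext e
  show (if e ∈ F then false else x₀ e) = false
  split_ifs with he
  · rfl
  · cases h : x₀ e with
    | false => rfl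
    | true => exact absurd (hF (mem_esupp.2 h)) he

/-- So no graph of that fibre has a `k`-clique avoiding `F` (`k ≥ 2`). [folklore] -/
theorem fibre_good_eq_empty {n j k : ℕ} (hk : 2 ≤ k) {x₀ : Edge n → Bool} (hx₀ : x₀ ∈ slice n j)
    {F : Finset (Edge n)} (hF : esupp x₀ ⊆ F) :
    ((slice n j).filter fun x => (∀ e ∈ F, x e = x₀ e) ∧ cliqueFn n k (zeroOn F x) = true) = ∅ := by
  refine filter_eq_empty_iff.2 fun x hx h => ?_
  obtain ⟨hagree, hcl⟩ := h
  have hmem : x ∈ (slice n j).filter fun x => ∀ e ∈ F, x e = x₀ e := mem_filter.2 ⟨hx, hagree⟩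
  rw [fibre_eq_singleton hx₀ hF, mem_singleton] at hmem
  subst hmem
  rw [zeroOn_eq_false_of_supp_subset hF, cliqueFn_false hk] at hcl
  exact Bool.false_ne_true hcl

/-- **One mechanism for both guards**: if the cap admits `#F = m_k(n)` for infinitely many `n`, T3's clause at `k ≥ 2` is
FALSE — take a point `x₀` of the central slice `j = m_k(n)`, `F := esupp x₀` (`#F = j`), `ρ := x₀`: the fibre is `{x₀}` and
none of it has a clique avoiding `F`, so `α·1 ≤ 0`. [folklore] -/
theorem not_fibreCliqueLowerWith_of_frequently {k : ℕ} (hk : 2 ≤ k) {B : ℕ → ℕ}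
    (hB : ∃ᶠ n : ℕ in atTop, thr k n ≤ B n) : ¬ FibreCliqueLowerWith k B := by
  rintro ⟨α, hα, H⟩
  obtain ⟨n, hBn, hn, hn1⟩ := (hB.and_eventually (H.and (eventually_ge_atTop 1))).exists
  have hjN : thr k n ≤ n.choose 2 := mk_le_choose hn1 hk
  obtain ⟨x₀, hx₀⟩ : (slice n (thr k n)).Nonempty := by
    rw [← card_pos, card_slice_eq_sliceCard, sliceCard_eq]
    exact Nat.choose_pos hjN
  have hF : #(esupp x₀) ≤ B n := by
    rw [card_esupp, (mem_filter.1 hx₀).2]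
    exact hBn
  have h := hn (thr k n) (central_thr k n) (esupp x₀) hF x₀
  rw [fibre_eq_singleton hx₀ subset_rfl, fibre_good_eq_empty hk hx₀ subset_rfl, card_singleton, card_empty,
    Nat.cast_one, mul_one, Nat.cast_zero] at h
  linarith

/-- `m_3(n) ≤ 3n`: for triangles the central slice fits inside a slot set of size `3n`. [folklore] -/
theorem thr_three_le (n : ℕ) : thr 3 n ≤ 3 * n := by
  rw [thr]
  refine Nat.floor_le_of_le ?_
  rcases Nat.eq_zero_or_pos n with rfl | hn
  · simp
  have hn0 : (0 : ℝ) < n := by exact_mod_cast hn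
  rw [show (-(2 : ℝ) / (((3 : ℕ) : ℝ) - 1)) = -1 by norm_num, Real.rpow_neg_one, Nat.cast_choose_two]
  rw [div_mul_eq_mul_div, div_le_iff₀ (by norm_num : (0 : ℝ) < 2)]
  have h1 : ((n : ℝ) * ((n : ℝ) - 1)) * (n : ℝ)⁻¹ = (n : ℝ) - 1 := by field_simp
  rw [h1]
  push_cast
  linarith

/-- **T3 is FALSE at `k = 3`** (its guard `4 ≤ k` is load-bearing): `m_3(n) = ⌊(n-1)/2⌋ ≤ 3n`, so the cap admits the
whole support of a central graph. [folklore] -/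
theorem fibreCliqueLower_false_at_three : ¬ FibreCliqueLowerWith 3 (fun n => 3 * n) :=
  not_fibreCliqueLowerWith_of_frequently (by norm_num) (Eventually.of_forall thr_three_le).frequently

/-- **T3 is FALSE without the cap on `#F`** (every `k ≥ 2`; cap `C(n,2)` = no cap). [folklore] -/
theorem fibreCliqueLower_false_uncapped {k : ℕ} (hk : 2 ≤ k) : ¬ FibreCliqueLowerWith k (fun n => n.choose 2) :=
  not_fibreCliqueLowerWith_of_frequently hk
    ((eventually_ge_atTop 1).mono fun _ hn => mk_le_choose hn hk).frequently

/-- Conversely the cap `3n` never admits `m_k(n)` for `k ≥ 4` (`m_k(n) ≥ n^{4/3}/2 - 1 > 3n` eventually), so this mechanism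
does not touch T3 itself; recorded as the threshold any admissible cap must respect: a cap `B` with `B n ≥ m_k(n)` infinitely
often kills the clause. [folklore] -/
theorem fibreCliqueLowerWith_cap_lt {k : ℕ} (hk : 2 ≤ k) {B : ℕ → ℕ} (H : FibreCliqueLowerWith k B) :
    ∀ᶠ n : ℕ in atTop, B n < thr k n := by
  by_contra h
  rw [not_eventually] at h
  exact not_fibreCliqueLowerWith_of_frequently hk (h.mono fun n hn => not_lt.1 hn) H

/-! ### T7 `ParitySliceHardFrom2` (open): witness shape and its exact relation to X(≥2) -/

/-- T7's inner clause at `(c, k, δ)`: eventually, on every central slice, every `{∧₂,∨₂}`-circuit that disagrees with the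
PARITY of the `k`-clique count on at most `δ·#slice_j` graphs has more than `n^c` gates. [folklore] -/
def ParityLB (c k : ℕ) (δ : ℝ) : Prop :=
  ∀ᶠ n : ℕ in atTop, ∀ j : ℕ, Central k n j → ∀ C : Circuit (Edge n), C.IsOver monotoneBasis →
    (#((slice n j).filter fun x => C.eval x ≠ decide (¬ 2 ∣ cliqueCount n k x)) : ℝ) ≤ δ * #(slice n j) →
      n ^ c < C.size

/-- T5's statement (landed as `stub_coincidenceTail2`; taken below as a hypothesis, its module being newer than this file's
import closure). [folklore] -/
def CoincidenceTail2Shape : Prop :=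
  ∀ k : ℕ, 3 ≤ k → ∀ ε : ℝ, 0 < ε → ∀ᶠ n : ℕ in atTop, ∀ j : ℕ, Central k n j →
    (#((slice n j).filter fun x => 2 ≤ cliqueCount n k x) : ℝ) ≤
      ((1 / (k.factorial : ℝ)) ^ 2 / 2 + ε) * #(slice n j)

/-- Off the tail `{ω_k ≥ 2}` the clique indicator IS the parity of the clique count. [folklore] -/
theorem cliqueFn_eq_parity_of_lt_two {n k : ℕ} (x : Edge n → Bool) (h : cliqueCount n k x < 2) :
    cliqueFn n k x = decide (¬ 2 ∣ cliqueCount n k x) := by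
  rcases Nat.lt_succ_iff_lt_or_eq.1 h with h1 | h1
  · have h0 : cliqueCount n k x = 0 := by omega
    rw [(cliqueCount_eq_zero_iff x).1 h0, h0]
    decide
  · rw [(cliqueCount_ne_zero_iff x).1 (by omega), h1]
    decide

/-- The parity-error set of the projection `x_{e₀}` lies in `{x_{e₀} = 1} ∪ {k-clique}` (an odd count is a positive
count). [folklore] -/
theorem parityErr_input_subset {n k j : ℕ} (e₀ : Edge n) :
    ((slice n j).filter fun x => (Circuit.input e₀).eval x ≠ decide (¬ 2 ∣ cliqueCount n k x)) ⊆
      (slice n j).filter (fun x => x e₀ = true) ∪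
        univ.filter (fun x : Edge n → Bool => edgeCount x = j ∧ cliqueFn n k x = true) := by
  intro x hx
  rw [mem_filter, Circuit.eval_input] at hx
  obtain ⟨hxs, hne⟩ := hx
  rw [mem_union, mem_filter, mem_filter]
  cases h0 : x e₀ with
  | true => exact Or.inl ⟨hxs, rfl⟩
  | false =>
    refine Or.inr ⟨mem_univ _, (mem_filter.1 hxs).2, ?_⟩
    rw [h0] at hne
    have hodd : ¬ 2 ∣ cliqueCount n k x := by
      intro hdiv
      apply hne
      rw [decide_eq_false (not_not_intro hdiv)]
    exact (cliqueCount_ne_zero_iff x).1 fun h0' => hodd (by rw [h0']; exact dvd_zero 2)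

/-- **T7's δ-ceiling** (every `c`, `k ≥ 2`): `δ > 1/k!` is impossible — `x_{e₀}` is `δ`-accurate for the parity too. [folklore] -/
theorem not_parityLB_of_factorial_inv_lt {c k : ℕ} {δ : ℝ} (hk : 2 ≤ k) (hδ : 1 / (k.factorial : ℝ) < δ) :
    ¬ ParityLB c k δ := by
  intro H
  have hε : 0 < δ - 1 / k.factorial := sub_pos.2 hδ
  have hev : ∀ᶠ n : ℕ in atTop, pc n k < δ - 1 / k.factorial :=
    (tendsto_pc hk).eventually (gt_mem_nhds hε)
  obtain ⟨n, hn, hpn, hn2⟩ := (H.and (hev.and (eventually_ge_atTop 2))).exists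
  obtain ⟨e₀⟩ := exists_edge hn2
  have hN : 0 < n.choose 2 := Nat.choose_pos hn2
  have hjT : (thr k n : ℝ) ≤ (n.choose 2 : ℕ) * (n : ℝ) ^ (-(2 : ℝ) / ((k : ℝ) - 1)) :=
    Nat.floor_le (by positivity)
  have hjN : thr k n ≤ n.choose 2 := mk_le_choose (by omega) hk
  have hratio : (thr k n : ℝ) / n.choose 2 ≤ pc n k := by
    rw [div_le_iff₀ (by exact_mod_cast hN), pc, mul_comm]
    exact hjT
  have herr : (#((slice n (thr k n)).filter fun x =>
      (Circuit.input e₀).eval x ≠ decide (¬ 2 ∣ cliqueCount n k x)) : ℝ) ≤ δ * #(slice n (thr k n)) :=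
    calc _ ≤ (#((slice n (thr k n)).filter (fun x => x e₀ = true) ∪
          univ.filter (fun x : Edge n → Bool => edgeCount x = thr k n ∧ cliqueFn n k x = true)) : ℝ) := by
          exact_mod_cast card_le_card (parityErr_input_subset e₀)
      _ ≤ ((thr k n : ℝ) / n.choose 2 + 1 / k.factorial) * #(slice n (thr k n)) :=
          card_onEdge_union_clique_le hk hn2 e₀ hjN hjT
      _ ≤ δ * #(slice n (thr k n)) := mul_le_mul_of_nonneg_right (by linarith) (Nat.cast_nonneg _)
  have hlt := hn (thr k n) (central_thr k n) (Circuit.input e₀) (input_isOver e₀ _) herr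
  rw [Circuit.size_input] at hlt
  exact Nat.not_lt_zero _ hlt

/-- The parity-error set of an EXACT clique detector lies in the tail `{ω_k ≥ 2}`. [folklore] -/
theorem parityErr_exact_subset {n k j : ℕ} {C : Circuit (Edge n)} (hC : ∀ x, C.eval x = cliqueFn n k x) :
    ((slice n j).filter fun x => C.eval x ≠ decide (¬ 2 ∣ cliqueCount n k x)) ⊆
      (slice n j).filter fun x => 2 ≤ cliqueCount n k x := by
  intro x hx
  rw [mem_filter] at hx ⊢
  refine ⟨hx.1, not_lt.1 fun hlt => hx.2 ?_⟩
  rw [hC x]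
  exact cliqueFn_eq_parity_of_lt_two x hlt

/-- **T7's witnesses have `k ≥ c + 1`** (modulo T5): for `3 ≤ k ≤ c` and ANY `δ > (1/k!)²` the clause `ParityLB c k δ`
is FALSE — the exact DNF (`≤ n^k ≤ n^c` gates) errs on the parity only on `{ω_k ≥ 2}`, of density `≤ (1/k!)²/2 + ε`. [folklore] -/
theorem not_parityLB_of_le (hT5 : CoincidenceTail2Shape) {c k : ℕ} {δ : ℝ} (hk : 3 ≤ k) (hkc : k ≤ c)
    (hδ : (1 / (k.factorial : ℝ)) ^ 2 < δ) : ¬ ParityLB c k δ := by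
  intro H
  have hε : 0 < δ - (1 / (k.factorial : ℝ)) ^ 2 := sub_pos.2 hδ
  obtain ⟨n, hn, h5, hnk⟩ := (H.and ((hT5 k hk _ hε).and (eventually_ge_atTop (k + 1)))).exists
  obtain ⟨C, hCB, hs, he⟩ := exists_monotone_cliqueCircuit (n := n) (k := k) (by omega) (by omega)
  have herr : (#((slice n (thr k n)).filter fun x => C.eval x ≠ decide (¬ 2 ∣ cliqueCount n k x)) : ℝ) ≤
      δ * #(slice n (thr k n)) :=
    calc _ ≤ (#((slice n (thr k n)).filter fun x => 2 ≤ cliqueCount n k x) : ℝ) := by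
          exact_mod_cast card_le_card (parityErr_exact_subset he)
      _ ≤ ((1 / (k.factorial : ℝ)) ^ 2 / 2 + (δ - (1 / (k.factorial : ℝ)) ^ 2)) * #(slice n (thr k n)) :=
          h5 (thr k n) (central_thr k n)
      _ ≤ δ * #(slice n (thr k n)) := by
          refine mul_le_mul_of_nonneg_right ?_ (Nat.cast_nonneg _)
          nlinarith [sq_nonneg (1 / (k.factorial : ℝ))]
  have hlt := hn (thr k n) (central_thr k n) C hCB herr
  have h1 : C.size ≤ n ^ k := hs.trans (dnfSize_le_pow hk)
  have h3 : n ^ k ≤ n ^ c := Nat.pow_le_pow_right (by omega) hkc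
  omega

/-- **X(c) with a larger δ gives T7's clause** (modulo T5): if `SliceLB c k δ_X` and `δ + (1/k!)²/2 < δ_X` then
`ParityLB c k δ` — a circuit `δ`-accurate for the parity is `(δ + (1/k!)²/2 + ε)`-accurate for `CLIQUE_k`, since the two
functions agree off `{ω_k ≥ 2}`. [folklore] -/
theorem parityLB_of_sliceLB (hT5 : CoincidenceTail2Shape) {c k : ℕ} {δ δX : ℝ} (hk : 3 ≤ k)
    (hgap : δ + (1 / (k.factorial : ℝ)) ^ 2 / 2 < δX) (H : SliceLB c k δX) : ParityLB c k δ := by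
  have hε : 0 < δX - δ - (1 / (k.factorial : ℝ)) ^ 2 / 2 := by linarith
  filter_upwards [H, hT5 k hk _ hε] with n hn h5 j hj C hCB herr
  refine hn j hj C hCB ?_
  have hsub : errSet n k j C ⊆ ((slice n j).filter fun x => C.eval x ≠ decide (¬ 2 ∣ cliqueCount n k x)) ∪
      (slice n j).filter fun x => 2 ≤ cliqueCount n k x := by
    intro x hx
    rw [errSet, mem_filter] at hx
    obtain ⟨-, hxj, hne⟩ := hx
    have hxs : x ∈ slice n j := mem_filter.2 ⟨mem_univ _, hxj⟩
    rw [mem_union, mem_filter, mem_filter]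
    by_cases hlt : cliqueCount n k x < 2
    · left
      exact ⟨hxs, by rwa [← cliqueFn_eq_parity_of_lt_two x hlt]⟩
    · exact Or.inr ⟨hxs, not_lt.1 hlt⟩
  calc (#(errSet n k j C) : ℝ)
      ≤ #(((slice n j).filter fun x => C.eval x ≠ decide (¬ 2 ∣ cliqueCount n k x)) ∪
          (slice n j).filter fun x => 2 ≤ cliqueCount n k x) := by exact_mod_cast card_le_card hsub
    _ ≤ (#((slice n j).filter fun x => C.eval x ≠ decide (¬ 2 ∣ cliqueCount n k x)) : ℝ) +
          #((slice n j).filter fun x => 2 ≤ cliqueCount n k x) := by exact_mod_cast card_union_le _ _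
    _ ≤ δ * #(slice n j) + ((1 / (k.factorial : ℝ)) ^ 2 / 2 + (δX - δ - (1 / (k.factorial : ℝ)) ^ 2 / 2)) *
          #(slice n j) := add_le_add herr (h5 j hj)
    _ = δX * #(slice n j) := by ring

/-- **T7 ⟸ X(≥2) with witnesses `δ_X > (3/2)(1/k!)²`** (modulo T5). The converse T7 ⟹ X(≥2) (with `δ_X = (δ-(1/k!)²)/4`)
is the line's `sliceLB_of_parity`; X alone, whose witness `δ_X` is only known to satisfy `δ_X ≤ 1/k!` (§2), is not seen to
give T7: the open stub is the crux conjunct strengthened by an error FLOOR. [folklore] -/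
theorem parityFrom2_of_sliceTarget_large (hT5 : CoincidenceTail2Shape)
    (h : ∀ c : ℕ, 2 ≤ c → ∃ k : ℕ, 3 ≤ k ∧ ∃ δX : ℝ, 3 / 2 * (1 / (k.factorial : ℝ)) ^ 2 < δX ∧ SliceLB c k δX) :
    ∀ c : ℕ, 2 ≤ c → ∃ k : ℕ, 3 ≤ k ∧ ∃ δ : ℝ, (1 / (k.factorial : ℝ)) ^ 2 < δ ∧ ParityLB c k δ := by
  intro c hc
  obtain ⟨k, hk, δX, hδX, H⟩ := h c hc
  refine ⟨k, hk, ((1 / (k.factorial : ℝ)) ^ 2 / 2 + δX) / 2, by linarith, ?_⟩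
  exact parityLB_of_sliceLB hT5 hk (by linarith) H

end Line

end Summit.PneNP.PneNP.Cruxes.SliceTarget.Disproof
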